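import Mathlib.Analysis.Complex.Basic
import Mathlib.FieldTheory.IntermediateField.Basic
import Mathlib.RingTheory.TensorProduct.Free
import Mathlib.LinearAlgebra.TensorProduct.Finiteness
import Mathlib.LinearAlgebra.DirectSum.Finsupp
import Mathlib.RingTheory.Flat.Basic
import Mathlib.LinearAlgebra.FiniteDimensional.Basic
import Mathlib.RingTheory.IntegralClosure.IsIntegralClosure.Basic
import Mathlib.LinearAlgebra.FreeModule.Finite.Matrix
import Literature.NumberTheory.Automorphic.ClozelAlgebraicity
import HarnessLib

/-!
# `IrreducibilityBySelfDuality.HeckeEigenvalueField`: the Hecke field of a RATIONAL STRUCTURE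
# (base-change form, no finite-dimensionality), and the reduction of the item to it
(item stmt-Langlands-13632 `HeckeEigenvalueField`, support, rank 1, route
`route-Langlands-IrreducibilityBySelfDuality`; `--supports` file, theorems only, Theses-free)

The item is Clozel 1990, Thm. 3.13 in Hecke-eigenvalue form (= the tree's named fact
`Literature.NumberTheory.Automorphic.Clozel1990_heckeEigenvalueField`, verbatim): for `π` regular
algebraic cuspidal on `GL_n(𝔸_K)` one number field `E ⊂ ℂ` contains the unramified Hecke
eigenvalues `t_{v,i} = q_v^{i(n-i)/2} e_i(α_v)` at almost all `v`. Clozel's proof (§3.5) has an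
analytic-geometric half — `π_f^{K_f} ⊗ H^•(𝔤, K_∞; π_∞ ⊗ V)` sits Hecke-equivariantly inside
`H^•_cusp(S_{K_f}, Ṽ) ⊗_{E₀} ℂ`, a complex vector space with an `E₀`-RATIONAL STRUCTURE stable
under the integral Hecke operators (Thm. 3.19, Lemme 3.15, `E₀ = ℚ(V)` a number field; Franke for
the comparison with cohomology) — and an algebraic half: eigenvalues of `E₀`-rational operators on
a common eigenvector of `M_{E₀} ⊗_{E₀} ℂ` generate a number field. The sibling module
`IrreducibilityBySelfDualityHeckeEigenvalueField` proves the algebraic half for a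
FINITE-DIMENSIONAL coordinate module `ℂ^d` with matrices over `E₀`.

This module proves the algebraic half in its natural, basis-free and DIMENSION-FREE form and
reduces the item to exactly the output of the geometric half:

* `exists_finiteDimensional_support` — for ANY `E₀`-vector space `V` (any field `E₀`, any
  commutative `E₀`-algebra `A`) and `x ∈ A ⊗[E₀] V`: `x` comes from `A ⊗ V₀` for a
  finite-dimensional `V₀ ≤ V` (the contractions `⟨f, x⟩`, `f ∈ Hom_{E₀}(A, E₀)`) stable under
  every `E₀`-linear `T` with `(1 ⊗ T) x = c • x`, the restriction keeping the eigen-relation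
  (`A ⊗ V₀ → A ⊗ V` is injective: `A` is flat over the field `E₀`). So NO finite-dimensionality
  of the ambient module (e.g. of the cohomology of an arithmetic group, a separate theorem of
  Borel–Serre/Raghunathan type) is needed for rationality of eigenvalues.
* `exists_numberField_forall_eigenvalue_baseChange_mem_of_finite` — `E₀ ⊆ ℂ` finite over `ℚ`,
  `W` finite-dimensional over `E₀`, `x₀ ∈ ℂ ⊗[E₀] W` non-zero: one number field contains every
  eigenvalue `c`, `(1 ⊗ T) x₀ = c • x₀`, `T ∈ End_{E₀}(W)` (the eigen-operators form an
  `E₀`-subspace of `End_{E₀} W`, the eigenvalue is `E₀`-linear on it, so the eigenvalues span a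
  finite-dimensional `ℚ`-subalgebra of `ℂ`, a field).
* `exists_numberField_forall_eigenvalue_baseChange_mem` — the two combined: ANY `V`.
* `heckeEigenvalueField_of_rationalStructure` /
  `clozel1990_heckeEigenvalueField_of_rationalStructure` — the item (resp. the named fact) follows
  from: every regular algebraic cuspidal `π` has, for some subfield `E₀ ⊆ ℂ` finite over `ℚ`, some
  `E₀`-vector space `V` and some non-zero `x ∈ ℂ ⊗_{E₀} V`, its Hecke eigenvalues `t_{v,i}` at
  almost all `v` realised as eigenvalues on `x` of base changes of `E₀`-linear endomorphisms of `V`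
  — Clozel's Thm. 3.19 + Lemme 3.15 verbatim in the tree's vocabulary (Mathlib `TensorProduct`,
  `LinearMap.baseChange`), the statement a cohomological development must supply.

What this does NOT do: discharge the item. Its `n = 1` slice is proved
(`IrreducibilityBySelfDualityHeckeEigenvalueFieldRankOne`, Weil); `n ≥ 2` needs the
(𝔤, K_∞)-cohomology of the arithmetic quotients of `Res_{K/ℚ} GL_n` with its rational Hecke-stable
structure (Clozel 1990 §3.5, Thm. 3.19; Franke 1998), absent from the tree and from Mathlib.
Theorems only: no definition, no named fact, no `sorry`; imports `Literature` + Mathlib only.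
-/

-- `Summit.Langlands.Langlands.…` (summit = sub-problem name, D-0017 layout) trips `dupNamespace` on
-- every declaration; the lakefile sets `weak.linter.dupNamespace = false` project-wide.
set_option linter.dupNamespace false

namespace Summit.Langlands.Langlands.Theorems.HeckeEigenvalueField

open scoped TensorProduct

section Contraction

variable {E₀ : Type*} [Field E₀] {A : Type*} [CommRing A] [Algebra E₀ A]
  {V : Type*} [AddCommGroup V] [Module E₀ V]

/-- The **contraction** of `A ⊗[E₀] V` against an `E₀`-linear functional `f` on `A`:
`c ⊗ v ↦ f(c) • v`. [folklore] -/
theorem lid_rTensor_tmul (f : A →ₗ[E₀] E₀) (c : A) (v : V) :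
    TensorProduct.lid E₀ V (f.rTensor V (c ⊗ₜ[E₀] v)) = f c • v := by
  rw [LinearMap.rTensor_tmul, TensorProduct.lid_tmul]

/-- Contraction commutes with base-changed endomorphisms:
`⟨f, (1 ⊗ T) y⟩ = T ⟨f, y⟩`. [folklore] -/
theorem lid_rTensor_baseChange (f : A →ₗ[E₀] E₀) (T : V →ₗ[E₀] V) (y : A ⊗[E₀] V) :
    TensorProduct.lid E₀ V (f.rTensor V (T.baseChange A y)) =
      T (TensorProduct.lid E₀ V (f.rTensor V y)) := by
  induction y using TensorProduct.induction_on with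
  | zero => simp
  | tmul c v => rw [LinearMap.baseChange_tmul, lid_rTensor_tmul, lid_rTensor_tmul, map_smul]
  | add y z hy hz => simp only [map_add, hy, hz]

/-- Contraction against `f` of `c • y` is contraction against `f ∘ (c · _)` of `y`. [folklore] -/
theorem lid_rTensor_smul (f : A →ₗ[E₀] E₀) (c : A) (y : A ⊗[E₀] V) :
    TensorProduct.lid E₀ V (f.rTensor V (c • y)) =
      TensorProduct.lid E₀ V ((f ∘ₗ LinearMap.mulLeft E₀ c).rTensor V y) := by
  induction y using TensorProduct.induction_on with
  | zero => simp
  | tmul c' v =>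
      rw [TensorProduct.smul_tmul', lid_rTensor_tmul, lid_rTensor_tmul, LinearMap.comp_apply,
        LinearMap.mulLeft_apply, smul_eq_mul]
  | add y z hy hz => simp only [smul_add, map_add, hy, hz]

/-- **Finite expansion along a basis of the coefficient ring.** For a basis `B` of `A` over
`E₀`, every `y ∈ A ⊗[E₀] V` is `∑_{b ∈ s} B_b ⊗ ⟨B^*_b, y⟩` for a finite set `s` of indices, the
coefficients being the contractions of `y` against the coordinate functionals `B^*_b`. [folklore] -/
theorem exists_finset_eq_sum_basis_tmul {ι : Type*} (B : Module.Basis ι E₀ A) (y : A ⊗[E₀] V) :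
    ∃ s : Finset ι, y = ∑ b ∈ s, B b ⊗ₜ[E₀] TensorProduct.lid E₀ V ((B.coord b).rTensor V y) := by
  classical
  -- coordinates: `Φ : A ⊗ V ≃ (ι →₀ V)`
  let Φ : A ⊗[E₀] V ≃ₗ[E₀] (ι →₀ V) :=
    TensorProduct.congr B.repr (LinearEquiv.refl E₀ V) ≪≫ₗ TensorProduct.finsuppScalarLeft E₀ V ι
  have hΦ : ∀ (z : A ⊗[E₀] V) (b : ι),
      Φ z b = TensorProduct.lid E₀ V ((B.coord b).rTensor V z) := by
    intro z b
    induction z using TensorProduct.induction_on with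
    | zero => simp
    | tmul c v =>
        rw [lid_rTensor_tmul, LinearEquiv.trans_apply, TensorProduct.congr_tmul,
          LinearEquiv.refl_apply, TensorProduct.finsuppScalarLeft_apply_tmul_apply,
          Module.Basis.coord_apply]
    | add y z hy hz => simp only [map_add, Finsupp.add_apply, hy, hz]
  have hΦsymm : ∀ (b : ι) (w : V), Φ.symm (Finsupp.single b w) = B b ⊗ₜ[E₀] w := by
    intro b w
    rw [LinearEquiv.symm_trans_apply, TensorProduct.finsuppScalarLeft_symm_apply_single,
      TensorProduct.congr_symm_tmul, LinearEquiv.refl_symm, LinearEquiv.refl_apply,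
      Module.Basis.repr_symm_single_one]
  refine ⟨(Φ y).support, ?_⟩
  conv_lhs => rw [← Φ.symm_apply_apply y, ← Finsupp.sum_single (Φ y), Finsupp.sum, map_sum]
  exact Finset.sum_congr rfl fun b _ => by rw [hΦsymm, hΦ]

end Contraction

section Support

variable {E₀ : Type*} [Field E₀] {A : Type*} [CommRing A] [Algebra E₀ A]
  {V : Type*} [AddCommGroup V] [Module E₀ V]

/-- **Finite support of a tensor, stable under its rational eigen-operators.** Let `E₀` be a
field, `A` a commutative `E₀`-algebra and `V` ANY `E₀`-vector space. Every `x ∈ A ⊗[E₀] V` comes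
from `A ⊗[E₀] V₀` for a FINITE-DIMENSIONAL subspace `V₀ ≤ V` (the span of the contractions
`⟨f, x⟩`, `f ∈ Hom_{E₀}(A, E₀)`) which is stable under every `E₀`-linear `T : V → V` having `x` as
an eigenvector after base change, `(1 ⊗ T) x = c • x` (`c ∈ A`); and the restriction `T|V₀` has
the preimage `x₀` of `x` as eigenvector with the same eigenvalue. (For `T (⟨f, x⟩) = ⟨f, (1 ⊗ T) x⟩
= ⟨f, c • x⟩ = ⟨f ∘ c, x⟩ ∈ V₀`; injectivity of `A ⊗ V₀ → A ⊗ V` by flatness of `A` over the field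
`E₀`.) This removes every finite-dimensionality hypothesis from the linear algebra behind fields
of rationality of eigenvalues (Clozel 1990, §3.1, proof of Thm. 3.13; Shimura 1971, Thm. 3.48).
[folklore] -/
theorem exists_finiteDimensional_support (x : A ⊗[E₀] V) :
    ∃ (V₀ : Submodule E₀ V) (_ : FiniteDimensional E₀ V₀) (x₀ : A ⊗[E₀] V₀),
      (V₀.subtype.baseChange A) x₀ = x ∧
      ∀ (T : V →ₗ[E₀] V) (c : A), T.baseChange A x = c • x →
        ∃ T₀ : V₀ →ₗ[E₀] V₀, V₀.subtype ∘ₗ T₀ = T ∘ₗ V₀.subtype ∧ T₀.baseChange A x₀ = c • x₀ := by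
  classical
  -- the support `V₀` of `x`: contractions of `x` against all `E₀`-linear functionals on `A`
  let ev : Module.Dual E₀ A →ₗ[E₀] V :=
    (TensorProduct.lid E₀ V).toLinearMap ∘ₗ LinearMap.applyₗ x ∘ₗ LinearMap.rTensorHom V
  have hev : ∀ f : Module.Dual E₀ A, ev f = TensorProduct.lid E₀ V (f.rTensor V x) := fun _ => rfl
  let V₀ : Submodule E₀ V := LinearMap.range ev
  have hmem : ∀ f : Module.Dual E₀ A, TensorProduct.lid E₀ V (f.rTensor V x) ∈ V₀ :=
    fun f => ⟨f, hev f⟩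
  -- (a) `V₀` is finite-dimensional: `x = ∑ cᵢ ⊗ vᵢ` and `⟨f, x⟩ = ∑ f(cᵢ) vᵢ`
  obtain ⟨S, hS⟩ := TensorProduct.exists_finset x
  have hle : V₀ ≤ Submodule.span E₀ (S.image Prod.snd : Set V) := by
    rintro _ ⟨f, rfl⟩
    rw [hev, hS, map_sum, map_sum]
    refine Submodule.sum_mem _ fun p hp => ?_
    rw [lid_rTensor_tmul]
    exact Submodule.smul_mem _ _ (Submodule.subset_span (by
      rw [Finset.coe_image]; exact Set.mem_image_of_mem _ hp))
  haveI : FiniteDimensional E₀ (Submodule.span E₀ (S.image Prod.snd : Set V)) :=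
    FiniteDimensional.span_of_finite E₀ (Finset.finite_toSet _)
  haveI hV₀ : FiniteDimensional E₀ V₀ := Submodule.finiteDimensional_of_le hle
  -- (b) `x` comes from `A ⊗ V₀`: expand along a basis of `A` over `E₀`
  let B := Module.Free.chooseBasis E₀ A
  obtain ⟨s, hs⟩ := exists_finset_eq_sum_basis_tmul B x
  let x₀ : A ⊗[E₀] V₀ := ∑ b ∈ s, B b ⊗ₜ[E₀] (⟨_, hmem (B.coord b)⟩ : V₀)
  have hjx : (V₀.subtype.baseChange A) x₀ = x := by
    rw [map_sum]
    conv_rhs => rw [hs]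
    exact Finset.sum_congr rfl fun b _ => by rw [LinearMap.baseChange_tmul, Submodule.subtype_apply]
  have hj : Function.Injective (V₀.subtype.baseChange A) :=
    Module.Flat.lTensor_preserves_injective_linearMap (M := A) V₀.subtype V₀.injective_subtype
  refine ⟨V₀, hV₀, x₀, hjx, fun T c hT => ?_⟩
  -- (c) `T` preserves `V₀`: `T ⟨f, x⟩ = ⟨f, (1 ⊗ T) x⟩ = ⟨f, c • x⟩ = ⟨f ∘ (c · _), x⟩`
  have hT₀ : ∀ w ∈ V₀, T w ∈ V₀ := by
    rintro _ ⟨f, rfl⟩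
    rw [hev, ← lid_rTensor_baseChange f T x, hT, lid_rTensor_smul]
    exact hmem _
  have hcomp : V₀.subtype ∘ₗ T.restrict hT₀ = T ∘ₗ V₀.subtype := LinearMap.ext fun _ => rfl
  refine ⟨T.restrict hT₀, hcomp, hj ?_⟩
  -- (d) the eigen-relation descends along the injection `A ⊗ V₀ → A ⊗ V`
  rw [map_smul, hjx, ← hT, ← hjx]
  change (V₀.subtype.baseChange A ∘ₗ (T.restrict hT₀).baseChange A) x₀ =
    (T.baseChange A ∘ₗ V₀.subtype.baseChange A) x₀
  rw [← LinearMap.baseChange_comp, ← LinearMap.baseChange_comp, hcomp]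

end Support

section Finite

variable (E₀ : Subfield ℂ) {W : Type*} [AddCommGroup W] [Module E₀ W]

/-- **The eigenvalue field of a vector, finite-dimensional case (base-change form).** Let
`E₀ ⊆ ℂ` be a subfield finite over `ℚ`, `W` a finite-dimensional `E₀`-vector space and
`x₀ ∈ ℂ ⊗[E₀] W` non-zero. Then ONE subfield `E ⊆ ℂ`, finite over `ℚ`, contains every `c ∈ ℂ`
with `(1 ⊗ T) x₀ = c • x₀` for SOME `E₀`-linear `T : W → W`. Proof: the `T` having `x₀` as
eigenvector form an `E₀`-subspace `𝒮` of `End_{E₀}(W)` (finite-dimensional), the eigenvalue is an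
`E₀`-linear map `𝒮 → ℂ`, so the set `C` of eigenvalues lies in the `ℚ`-span of finitely many
complex numbers; `C` is a `ℚ`-subalgebra of `ℂ` (compose / add the operators), hence a
finite-dimensional domain over `ℚ`, hence a field (Mathlib `isField_of_isIntegral_of_isField'`).
This is the linear algebra of fields of rationality of Hecke eigenvalues (Shimura 1971, Thm. 3.48;
Clozel 1990, §3.1 and proof of Thm. 3.13), in the basis-free form `ℂ ⊗_{E₀} W`. [folklore] -/
theorem exists_numberField_forall_eigenvalue_baseChange_mem_of_finite [FiniteDimensional ℚ E₀]
    [FiniteDimensional E₀ W] {x₀ : ℂ ⊗[E₀] W} (hx₀ : x₀ ≠ 0) :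
    ∃ E : Subfield ℂ, FiniteDimensional ℚ E ∧
      ∀ (T : W →ₗ[E₀] W) (c : ℂ), T.baseChange ℂ x₀ = c • x₀ → c ∈ E := by
  classical
  have uniq : ∀ {c c' : ℂ}, c • x₀ = c' • x₀ → c = c' := fun h => smul_left_injective ℂ hx₀ h
  -- the eigen-operators of `x₀`, an `E₀`-subspace of `End_{E₀}(W)`
  let S : Submodule E₀ (Module.End E₀ W) :=
    { carrier := {T | ∃ c : ℂ, T.baseChange ℂ x₀ = c • x₀}
      add_mem' := by
        rintro T U ⟨c, hc⟩ ⟨d, hd⟩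
        exact ⟨c + d, by rw [LinearMap.baseChange_add, LinearMap.add_apply, hc, hd, add_smul]⟩
      zero_mem' := ⟨0, by rw [LinearMap.baseChange_zero, LinearMap.zero_apply, zero_smul]⟩
      smul_mem' := by
        rintro e T ⟨c, hc⟩
        refine ⟨e • c, ?_⟩
        rw [LinearMap.baseChange_smul, LinearMap.smul_apply, hc]
        exact (smul_assoc e c x₀).symm }
  have hmemS : ∀ {T : Module.End E₀ W}, T ∈ S ↔ ∃ c : ℂ, T.baseChange ℂ x₀ = c • x₀ := Iff.rfl
  -- the eigenvalue, an `E₀`-linear map `S → ℂ`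
  have hS : ∀ T : S, ∃ c : ℂ, (T : Module.End E₀ W).baseChange ℂ x₀ = c • x₀ := fun T => T.2
  choose evf hevf using hS
  let ev : S →ₗ[E₀] ℂ :=
    { toFun := evf
      map_add' := fun T U => uniq (by
        rw [← hevf, Submodule.coe_add, LinearMap.baseChange_add, LinearMap.add_apply, hevf, hevf,
          add_smul])
      map_smul' := fun e T => uniq (by
        rw [← hevf, Submodule.coe_smul, LinearMap.baseChange_smul, LinearMap.smul_apply, hevf,
          RingHom.id_apply]
        exact (smul_assoc e (evf T) x₀).symm) }
  have hev : ∀ T : S, ev T = evf T := fun _ => rfl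
  -- the eigenvalues lie in the `ℚ`-span of finitely many complex numbers
  let bS := Module.finBasis E₀ S
  let bQ := Module.finBasis ℚ E₀
  let Vℚ : Submodule ℚ ℂ := Submodule.span ℚ
    (Set.range fun p : Fin (Module.finrank E₀ S) × Fin (Module.finrank ℚ E₀) =>
      ((bQ p.2 : E₀) : ℂ) * ev (bS p.1))
  haveI : FiniteDimensional ℚ Vℚ := FiniteDimensional.span_of_finite ℚ (Set.finite_range _)
  have hcV : ∀ (T : W →ₗ[E₀] W) (c : ℂ), T.baseChange ℂ x₀ = c • x₀ → c ∈ Vℚ := by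
    intro T c hT
    have hTS : T ∈ S := hmemS.mpr ⟨c, hT⟩
    have hc : c = ev ⟨T, hTS⟩ := uniq (by rw [← hT, hev, ← hevf])
    rw [hc, ← bS.sum_repr ⟨T, hTS⟩, map_sum]
    refine Submodule.sum_mem _ fun k _ => ?_
    rw [map_smul, Subfield.smul_def, smul_eq_mul, ← bQ.sum_repr (bS.repr ⟨T, hTS⟩ k),
      AddSubmonoidClass.coe_finsetSum, Finset.sum_mul]
    refine Submodule.sum_mem _ fun j _ => ?_
    rw [Rat.smul_def, Subfield.coe_mul, SubfieldClass.coe_ratCast, mul_assoc, ← Rat.smul_def]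
    exact Submodule.smul_mem _ _ (Submodule.subset_span ⟨(k, j), rfl⟩)
  -- the eigenvalues form a `ℚ`-subalgebra of `ℂ`
  let C : Subalgebra ℚ ℂ :=
    { carrier := {c | ∃ T : W →ₗ[E₀] W, T.baseChange ℂ x₀ = c • x₀}
      mul_mem' := by
        rintro c d ⟨T, hT⟩ ⟨U, hU⟩
        refine ⟨T ∘ₗ U, ?_⟩
        rw [LinearMap.baseChange_comp, LinearMap.comp_apply, hU, map_smul, hT, smul_smul, mul_comm]
      one_mem' := ⟨LinearMap.id, by rw [LinearMap.baseChange_id, LinearMap.id_apply, one_smul]⟩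
      add_mem' := by
        rintro c d ⟨T, hT⟩ ⟨U, hU⟩
        exact ⟨T + U, by rw [LinearMap.baseChange_add, LinearMap.add_apply, hT, hU, add_smul]⟩
      zero_mem' := ⟨0, by rw [LinearMap.baseChange_zero, LinearMap.zero_apply, zero_smul]⟩
      algebraMap_mem' := fun r => ⟨(r : E₀) • LinearMap.id, by
        rw [LinearMap.baseChange_smul, LinearMap.smul_apply, LinearMap.baseChange_id,
          LinearMap.id_apply, eq_ratCast]
        exact (algebraMap_smul ℂ (r : E₀) x₀).symm.trans
          (congrArg (· • x₀) (SubfieldClass.coe_ratCast E₀ r))⟩ }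
  have hmemC : ∀ {c : ℂ}, c ∈ C ↔ ∃ T : W →ₗ[E₀] W, T.baseChange ℂ x₀ = c • x₀ := Iff.rfl
  have hCle : Subalgebra.toSubmodule C ≤ Vℚ := fun c ⟨T, hT⟩ => hcV T c hT
  haveI hfin : FiniteDimensional ℚ C :=
    Subalgebra.finiteDimensional_toSubmodule.mp (Submodule.finiteDimensional_of_le hCle)
  have hfield : IsField C := isField_of_isIntegral_of_isField' (Field.toIsField ℚ)
  refine ⟨(C.toIntermediateField' hfield).toSubfield, hfin, fun T c hT => ?_⟩
  change c ∈ C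
  exact hmemC.mpr ⟨T, hT⟩

end Finite

section General

variable (E₀ : Subfield ℂ) {V : Type*} [AddCommGroup V] [Module E₀ V]

/-- **The eigenvalue field of a vector in a rational structure (base-change form, any
dimension).** Let `E₀ ⊆ ℂ` be a subfield finite over `ℚ`, `V` ANY `E₀`-vector space and
`x ∈ ℂ ⊗[E₀] V` non-zero. Then one subfield `E ⊆ ℂ`, finite over `ℚ`, contains every `c ∈ ℂ`
such that `(1 ⊗ T) x = c • x` for some `E₀`-linear `T : V → V`. (Support reduction
`exists_finiteDimensional_support` + the finite-dimensional case.) This is the exact algebraic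
input by which an `E₀`-rational structure on a complex vector space carrying a Hecke action —
e.g. `H^•_cusp(S_{K_f}, Ṽ_{E₀}) ⊗_{E₀} ℂ` (Clozel 1990, Thm. 3.19, Lemme 3.15) — forces the
eigenvalues on any common eigenvector to lie in ONE number field, with no finite-dimensionality
of the space. [folklore] -/
theorem exists_numberField_forall_eigenvalue_baseChange_mem [FiniteDimensional ℚ E₀]
    {x : ℂ ⊗[E₀] V} (hx : x ≠ 0) :
    ∃ E : Subfield ℂ, FiniteDimensional ℚ E ∧
      ∀ (T : V →ₗ[E₀] V) (c : ℂ), T.baseChange ℂ x = c • x → c ∈ E := by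
  obtain ⟨V₀, hV₀, x₀, hx₀x, hT₀⟩ := exists_finiteDimensional_support x
  have hx₀ : x₀ ≠ 0 := by
    rintro rfl
    exact hx (by rw [← hx₀x, map_zero])
  obtain ⟨E, hE, hmem⟩ := exists_numberField_forall_eigenvalue_baseChange_mem_of_finite E₀ hx₀
  refine ⟨E, hE, fun T c hT => ?_⟩
  obtain ⟨T₀, -, h⟩ := hT₀ T c hT
  exact hmem T₀ c h

/-- **Subset form (an `E₀`-form inside a complex vector space).** Let `M` be a complex vector
space and `ι : ℂ ⊗[E₀] V →ₗ[ℂ] M` an INJECTIVE comparison map from the base change of an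
`E₀`-vector space `V` (`E₀ ⊆ ℂ` finite over `ℚ`) — an `E₀`-rational structure on its image. If a
non-zero `m` in the image is an eigenvector, `S m = c • m`, of complex operators `S` that are
DEFINED OVER `E₀` (`S ∘ ι = ι ∘ (1 ⊗ T)` for some `E₀`-linear `T`), then all such eigenvalues `c`
lie in one number field. (The form in which comparison isomorphisms are used: Clozel 1990, §3.1,
"`π_f` est définie sur `E`".) [folklore] -/
theorem exists_numberField_forall_eigenvalue_mem_of_rationalForm [FiniteDimensional ℚ E₀]
    {M : Type*} [AddCommGroup M] [Module ℂ M] (ι : ℂ ⊗[E₀] V →ₗ[ℂ] M)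
    (hι : Function.Injective ι) {x : ℂ ⊗[E₀] V} (hx : x ≠ 0) :
    ∃ E : Subfield ℂ, FiniteDimensional ℚ E ∧
      ∀ (S : M →ₗ[ℂ] M) (c : ℂ), (∃ T : V →ₗ[E₀] V, S ∘ₗ ι = ι ∘ₗ T.baseChange ℂ) →
        S (ι x) = c • ι x → c ∈ E := by
  obtain ⟨E, hE, hmem⟩ := exists_numberField_forall_eigenvalue_baseChange_mem E₀ hx
  refine ⟨E, hE, fun S c ⟨T, hT⟩ hS => hmem T c (hι ?_)⟩
  rw [map_smul, ← hS]
  exact (LinearMap.congr_fun hT x).symm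

end General

/-! ### The reduction of the item to a rational structure -/

section Reduction

open Filter Literature.NumberTheory.Automorphic IsDedekindDomain NumberField

/-- **`HeckeEigenvalueField` from a rational structure** (Clozel 1990, Thm. 3.13 reduced to
Thm. 3.19 + Lemme 3.15). Hypothesis (the cohomological input, NOT in the tree): for every regular
algebraic cuspidal `π` on `GL_n(𝔸_K)` there are a subfield `E₀ ⊆ ℂ` finite over `ℚ`, an
`E₀`-vector space `V` (any dimension) and a non-zero `x ∈ ℂ ⊗_{E₀} V` such that for all but
finitely many finite places `v`, for every Satake parameter `α` of `π` at `v` and every `i ≤ n`,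
the Hecke eigenvalue `t_{v,i} = (√q_v)^{i(n-i)} e_i(α)` is the eigenvalue on `x` of the base change
`1 ⊗ T` of some `E₀`-linear `T : V → V` (in Clozel's proof: `V = H^•_cusp(S_{K_f}, Ṽ_{E₀})`,
`x` = a class of `π_f^{K_f} ⊗ H^•(𝔤, K_∞; π_∞ ⊗ V_ℂ)`, `T` = the double-coset operator
`[K_f t_{v,i} K_f]`, defined over `E₀`). Conclusion: the text of the input item
`IrreducibilityBySelfDuality.HeckeEigenvalueField`, by
`exists_numberField_forall_eigenvalue_baseChange_mem`. [cite: Clozel1990, Thm. 3.13, Thm. 3.19 and Lemme 3.15] -/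
theorem heckeEigenvalueField_of_rationalStructure
    (H : ∀ (n : ℕ) (K : Type) [Field K] [NumberField K] (hcpt : isCompact_glFiniteIntegralLevel n K)
      (π : CuspidalAutomorphicRepData n K hcpt), π.1.IsRegularAlgebraic →
      ∃ (E₀ : Subfield ℂ) (_ : FiniteDimensional ℚ E₀) (V : Type) (_ : AddCommGroup V)
        (_ : Module E₀ V) (x : ℂ ⊗[E₀] V), x ≠ 0 ∧
        ∀ᶠ v : HeightOneSpectrum (𝓞 K) in cofinite, ∀ α : Multiset ℂ,
          π.1.HasSatakeParamAt v α → ∀ i ≤ n, ∃ T : V →ₗ[E₀] V,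
            T.baseChange ℂ x =
              (((((Real.sqrt (v.residueCard : ℝ)) : ℝ) : ℂ) ^ (i * (n - i))) * α.esymm i) • x) :
    ∀ (n : ℕ) (K : Type) [Field K] [NumberField K] (hcpt : _)
      (π : Literature.NumberTheory.Automorphic.CuspidalAutomorphicRepData n K hcpt),
      π.1.IsRegularAlgebraic → ∃ E : Subfield ℂ, FiniteDimensional ℚ E ∧ ∀ᶠ v in cofinite,
        ∀ α : Multiset ℂ, π.1.HasSatakeParamAt v α → ∀ i ≤ n,
          ((((Real.sqrt (v.residueCard : ℝ)) : ℝ) : ℂ) ^ (i * (n - i))) * α.esymm i ∈ E := by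
  intro n K _ _ hcpt π hπ
  obtain ⟨E₀, hE₀, V, _, _, x, hx, hv⟩ := H n K hcpt π hπ
  obtain ⟨E, hE, hmem⟩ := exists_numberField_forall_eigenvalue_baseChange_mem E₀ hx
  refine ⟨E, hE, ?_⟩
  filter_upwards [hv] with v hv α hα i hi
  obtain ⟨T, hT⟩ := hv α hα i hi
  exact hmem T _ hT

/-- The same reduction with the named fact as conclusion: a rational structure carrying the
eigensystem of every regular algebraic cuspidal `π` DISCHARGES `Clozel1990_heckeEigenvalueField`
(and with it the item, to which it is definitionally equal). [cite: Clozel1990, Thm. 3.13, Thm. 3.19 and Lemme 3.15] -/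
theorem clozel1990_heckeEigenvalueField_of_rationalStructure
    (H : ∀ (n : ℕ) (K : Type) [Field K] [NumberField K] (hcpt : isCompact_glFiniteIntegralLevel n K)
      (π : CuspidalAutomorphicRepData n K hcpt), π.1.IsRegularAlgebraic →
      ∃ (E₀ : Subfield ℂ) (_ : FiniteDimensional ℚ E₀) (V : Type) (_ : AddCommGroup V)
        (_ : Module E₀ V) (x : ℂ ⊗[E₀] V), x ≠ 0 ∧
        ∀ᶠ v : HeightOneSpectrum (𝓞 K) in cofinite, ∀ α : Multiset ℂ,
          π.1.HasSatakeParamAt v α → ∀ i ≤ n, ∃ T : V →ₗ[E₀] V,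
            T.baseChange ℂ x =
              (((((Real.sqrt (v.residueCard : ℝ)) : ℝ) : ℂ) ^ (i * (n - i))) * α.esymm i) • x) :
    Clozel1990_heckeEigenvalueField :=
  heckeEigenvalueField_of_rationalStructure H

end Reduction

end Summit.Langlands.Langlands.Theorems.HeckeEigenvalueField
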